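import Mathlib

/-!
# T-S5.13e `ErrorBudget` — the pure real-analysis largeness lemmas of ASSEMBLY-S5 §6–§8 (planner ym-idea-2 g18, 2026-08-29T20:15:08Z (4);
# LINE-19 S5 ⟨stmt-QuantumFields-24004⟩/⟨24335⟩, T-S5.13 assembler = LEAD sfw-p2)

Width seat `ym-line-sfw-p2-w2` (g31).  Every largeness condition "for `β ≥ β₀`" of the T-S5.13 script (`Cruxes/BoxHighWindowsSU22/ASSEMBLY-S5.md` §1 (F1)–(F7),
§5 sup bounds, §6 (e1)–(e6), §8) has one of three shapes, with `H = ⌈β^θ⌉₊` entering only through `β^θ ≤ H ≤ β^θ + 1`: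
* `C·H^k·(1+log H)^m·(1+log β)^n / β^γ ≤ ε` with `k·θ < γ` — **`exists_forall_natPow_log_le`** (from `exists_forall_log_pow_div_rpow_le`:
  `C(1+log β)^m/β^γ ≤ ε` for `β ≥ β₀`, `γ > 0`, via `log β ≤ β^δ/δ`, ✓`Real.log_le_rpow_div`, with the EXPLICIT threshold
  `β₀ = max 1 ((C·(1+1/δ)^m/ε)^{2/γ})`, `δ = γ/(2(m+1))`);
* `C·H^k·β^a·exp(−c·β^γ) ≤ ε` with `c, γ > 0` — **`exists_forall_natPow_exp_le`** (`exp(−x) ≤ N!/x^N`, ✓`Real.pow_div_factorial_le_exp`);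
* `C·H^k·β^a·exp(A·β^{γ₁} + A′·β^{γ₁′}(1+log β)^m − c·β^{γ₂}) ≤ ε` with `γ₁, γ₁′ < γ₂`, `c > 0` — **`exists_forall_natPow_exp_sub_le`** (Step C, (e2)).
`errorBudget_six` packages the nine monomials of §6 (e1)–(e6) at the exponents of §1/§7 (`12θ < 1`, `θ/2 < κ₃ < (1/2−4θ)/3`, `κ₃ < ε₁ < 1/2−6θ+2κ₃`):
one `β₀` past which each is `≤ 1/32`.

Everything proved, Mathlib only, standard axioms; no definitions.
HONEST LABEL: bookkeeping lemmas for the T-S5.13 assembly of the XL stub S5 (`stub_landauSecondOrder`) of a critic-PASSed DRAFT line; S5, U5, ⟨24004⟩ ⟨24335⟩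
⟨24336⟩ remain OPEN; no stub is closed by name, no crux, rung or summit is proved; **the Yang–Mills mass gap is NOT proved by this file.**
-/

set_option autoImplicit false

noncomputable section

open Real

namespace Summit.QuantumFields.YangMills.Theorems.AllWindowsColdBoxBoxHighLine

namespace ErrorBudget

/-! ## Logarithms against powers -/

/-- `0 ≤ 1 + log β` for `β ≥ 1`. -/
theorem one_add_log_nonneg {β : ℝ} (hβ : 1 ≤ β) : 0 ≤ 1 + Real.log β := by
  have := Real.log_nonneg hβ
  linarith

/-- `1 + log β ≤ (1 + 1/δ)·β^δ` for `β ≥ 1`, `δ > 0` (✓`Real.log_le_rpow_div`). -/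
theorem one_add_log_le {δ β : ℝ} (hδ : 0 < δ) (hβ : 1 ≤ β) : 1 + Real.log β ≤ (1 + 1 / δ) * β ^ δ := by
  have h1 : Real.log β ≤ β ^ δ / δ := Real.log_le_rpow_div (by linarith) hδ
  have h2 : 1 ≤ β ^ δ := Real.one_le_rpow hβ hδ.le
  have h3 : (1 + 1 / δ) * β ^ δ = β ^ δ + β ^ δ / δ := by ring
  linarith

/-- `(1 + log β)^m ≤ (1 + 1/δ)^m·β^{mδ}` for `β ≥ 1`, `δ > 0`. -/
theorem one_add_log_pow_le {δ β : ℝ} (hδ : 0 < δ) (hβ : 1 ≤ β) (m : ℕ) :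
    (1 + Real.log β) ^ m ≤ (1 + 1 / δ) ^ m * β ^ ((m : ℝ) * δ) := by
  have hβ0 : 0 ≤ β := by linarith
  calc (1 + Real.log β) ^ m ≤ ((1 + 1 / δ) * β ^ δ) ^ m := pow_le_pow_left₀ (one_add_log_nonneg hβ) (one_add_log_le hδ hβ) m
    _ = (1 + 1 / δ) ^ m * (β ^ δ) ^ m := mul_pow _ _ _
    _ = (1 + 1 / δ) ^ m * β ^ ((m : ℝ) * δ) := by
        rw [← Real.rpow_natCast (β ^ δ) m, ← Real.rpow_mul hβ0, mul_comm δ]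

/-- **`C·(1+log β)^m / β^γ ≤ ε` for `β ≥ β₀`** (`γ > 0`, `ε > 0`; explicit `β₀ ≥ 1`). -/
theorem exists_forall_log_pow_div_rpow_le {γ ε : ℝ} (hγ : 0 < γ) (hε : 0 < ε) (C : ℝ) (m : ℕ) :
    ∃ β₀ : ℝ, 1 ≤ β₀ ∧ ∀ β : ℝ, β₀ ≤ β → C * (1 + Real.log β) ^ m / β ^ γ ≤ ε := by
  by_cases hC : C ≤ 0
  · refine ⟨1, le_rfl, fun β hβ => ?_⟩
    have h0 : 0 ≤ (1 + Real.log β) ^ m / β ^ γ :=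
      div_nonneg (pow_nonneg (one_add_log_nonneg hβ) m) (Real.rpow_nonneg (by linarith) γ)
    have : C * (1 + Real.log β) ^ m / β ^ γ = C * ((1 + Real.log β) ^ m / β ^ γ) := by ring
    rw [this]
    exact (mul_nonpos_iff.2 (Or.inr ⟨hC, h0⟩)).trans hε.le
  push Not at hC
  set δ : ℝ := γ / (2 * ((m : ℝ) + 1)) with hδ
  have hδ0 : 0 < δ := by positivity
  set K : ℝ := (1 + 1 / δ) ^ m with hK
  have hK0 : 0 < K := by positivity
  have hmδ : (m : ℝ) * δ ≤ γ / 2 := by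
    rw [hδ, mul_div_assoc']
    rw [div_le_div_iff₀ (by positivity) (by positivity)]
    nlinarith [hγ.le]
  have hx : 0 ≤ C * K / ε := by positivity
  set β₀ : ℝ := max 1 ((C * K / ε) ^ (2 / γ)) with hβ₀
  refine ⟨β₀, le_max_left _ _, fun β hβ => ?_⟩
  have hβ1 : 1 ≤ β := (le_max_left _ _).trans hβ
  have hβ0 : 0 < β := by linarith
  have h1 : (1 + Real.log β) ^ m ≤ K * β ^ (γ / 2) :=
    (one_add_log_pow_le hδ0 hβ1 m).trans (mul_le_mul_of_nonneg_left (Real.rpow_le_rpow_of_exponent_le hβ1 hmδ) hK0.le)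
  have h2 : C * K / ε ≤ β ^ (γ / 2) := by
    have e1 : ((C * K / ε) ^ (2 / γ)) ^ (γ / 2) = C * K / ε := by
      rw [← Real.rpow_mul hx]
      have : 2 / γ * (γ / 2) = 1 := by field_simp
      rw [this, Real.rpow_one]
    calc C * K / ε = ((C * K / ε) ^ (2 / γ)) ^ (γ / 2) := e1.symm
      _ ≤ β₀ ^ (γ / 2) := Real.rpow_le_rpow (Real.rpow_nonneg hx _) (le_max_right _ _) (by positivity)
      _ ≤ β ^ (γ / 2) := Real.rpow_le_rpow (by positivity) hβ (by positivity)
  have hsplit : β ^ γ = β ^ (γ / 2) * β ^ (γ / 2) := by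
    rw [← Real.rpow_add hβ0]; ring_nf
  have hβγ2 : 0 < β ^ (γ / 2) := Real.rpow_pos_of_pos hβ0 _
  rw [div_le_iff₀ (Real.rpow_pos_of_pos hβ0 γ), hsplit]
  calc C * (1 + Real.log β) ^ m ≤ C * (K * β ^ (γ / 2)) := mul_le_mul_of_nonneg_left h1 hC.le
    _ = (C * K / ε) * β ^ (γ / 2) * ε := by field_simp
    _ ≤ β ^ (γ / 2) * β ^ (γ / 2) * ε := by
        have := mul_le_mul_of_nonneg_right h2 hβγ2.le
        nlinarith
    _ = ε * (β ^ (γ / 2) * β ^ (γ / 2)) := by ring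

/-! ## The box side `H = ⌈β^θ⌉₊` enters through `β^θ ≤ H ≤ β^θ + 1` -/

/-- `H ≤ 2β^θ`. -/
theorem natCast_le_two_mul_rpow {β θ : ℝ} {H : ℕ} (hβ : 1 ≤ β) (hθ : 0 ≤ θ) (hH : (H : ℝ) ≤ β ^ θ + 1) : (H : ℝ) ≤ 2 * β ^ θ := by
  have := Real.one_le_rpow hβ hθ
  linarith

/-- `H^k ≤ 2^k·β^{kθ}`. -/
theorem natCast_pow_le {β θ : ℝ} {H : ℕ} (hβ : 1 ≤ β) (hθ : 0 ≤ θ) (hH : (H : ℝ) ≤ β ^ θ + 1) (k : ℕ) :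
    (H : ℝ) ^ k ≤ 2 ^ k * β ^ ((k : ℝ) * θ) := by
  have hβ0 : 0 ≤ β := by linarith
  calc (H : ℝ) ^ k ≤ (2 * β ^ θ) ^ k := pow_le_pow_left₀ (Nat.cast_nonneg H) (natCast_le_two_mul_rpow hβ hθ hH) k
    _ = 2 ^ k * (β ^ θ) ^ k := mul_pow _ _ _
    _ = 2 ^ k * β ^ ((k : ℝ) * θ) := by rw [← Real.rpow_natCast (β ^ θ) k, ← Real.rpow_mul hβ0, mul_comm θ]

/-- `1 + log H ≤ (2 + θ)(1 + log β)`. -/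
theorem one_add_log_natCast_le {β θ : ℝ} {H : ℕ} (hβ : 1 ≤ β) (hθ : 0 ≤ θ) (h1 : 1 ≤ H) (hH : (H : ℝ) ≤ β ^ θ + 1) :
    1 + Real.log H ≤ (2 + θ) * (1 + Real.log β) := by
  have hβ0 : 0 < β := by linarith
  have hH0 : 0 < (H : ℝ) := by exact_mod_cast h1
  have hlog : Real.log H ≤ Real.log (2 * β ^ θ) := Real.log_le_log hH0 (natCast_le_two_mul_rpow hβ hθ hH)
  rw [Real.log_mul two_ne_zero (Real.rpow_pos_of_pos hβ0 θ).ne', Real.log_rpow hβ0] at hlog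
  have hl2 : Real.log 2 < 1 := by
    have := Real.log_two_lt_d9
    linarith
  have hlb : 0 ≤ Real.log β := Real.log_nonneg hβ
  nlinarith

/-- `(1 + log H)^m ≤ (2 + θ)^m (1 + log β)^m`. -/
theorem one_add_log_natCast_pow_le {β θ : ℝ} {H : ℕ} (hβ : 1 ≤ β) (hθ : 0 ≤ θ) (h1 : 1 ≤ H) (hH : (H : ℝ) ≤ β ^ θ + 1) (m : ℕ) :
    (1 + Real.log H) ^ m ≤ (2 + θ) ^ m * (1 + Real.log β) ^ m := by
  rw [← mul_pow]
  have h0 : 0 ≤ 1 + Real.log (H : ℝ) := one_add_log_nonneg (by exact_mod_cast h1)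
  exact pow_le_pow_left₀ h0 (one_add_log_natCast_le hβ hθ h1 hH) m

/-- **Power-times-log errors**: `k·θ < γ` ⇒ `C·H^k·(1+log H)^m·(1+log β)^n / β^γ ≤ ε` for `β ≥ β₀`, uniformly in `1 ≤ H ≤ β^θ + 1`. -/
theorem exists_forall_natPow_log_le {θ γ ε : ℝ} {k : ℕ} (hθ : 0 ≤ θ) (hk : (k : ℝ) * θ < γ) (hε : 0 < ε) (C : ℝ) (m n : ℕ) :
    ∃ β₀ : ℝ, 1 ≤ β₀ ∧ ∀ β : ℝ, β₀ ≤ β → ∀ H : ℕ, 1 ≤ H → (H : ℝ) ≤ β ^ θ + 1 →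
      C * (H : ℝ) ^ k * (1 + Real.log H) ^ m * (1 + Real.log β) ^ n / β ^ γ ≤ ε := by
  obtain ⟨β₀, hβ₀1, hβ₀⟩ :=
    exists_forall_log_pow_div_rpow_le (sub_pos.2 hk) hε (max C 0 * 2 ^ k * (2 + θ) ^ m) (m + n)
  refine ⟨β₀, hβ₀1, fun β hβ H hH1 hH => ?_⟩
  have hβ1 : 1 ≤ β := hβ₀1.trans hβ
  have hβ0 : 0 < β := by linarith
  have hC : C ≤ max C 0 := le_max_left _ _
  have hC0 : 0 ≤ max C 0 := le_max_right _ _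
  have hHk := natCast_pow_le hβ1 hθ hH k
  have hlg := one_add_log_natCast_pow_le hβ1 hθ hH1 hH m
  have hL0 : 0 ≤ (1 + Real.log (H : ℝ)) ^ m := pow_nonneg (one_add_log_nonneg (by exact_mod_cast hH1)) m
  have hB0 : 0 ≤ (1 + Real.log β) ^ n := pow_nonneg (one_add_log_nonneg hβ1) n
  have hγ0 : 0 < β ^ γ := Real.rpow_pos_of_pos hβ0 γ
  -- compare with the `(1+log β)^{m+n} / β^{γ − kθ}` form
  have hsplit : β ^ γ = β ^ ((k : ℝ) * θ) * β ^ (γ - (k : ℝ) * θ) := by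
    rw [← Real.rpow_add hβ0]; ring_nf
  have key : C * (H : ℝ) ^ k * (1 + Real.log H) ^ m * (1 + Real.log β) ^ n ≤
      max C 0 * 2 ^ k * (2 + θ) ^ m * (1 + Real.log β) ^ (m + n) * β ^ ((k : ℝ) * θ) := by
    calc C * (H : ℝ) ^ k * (1 + Real.log H) ^ m * (1 + Real.log β) ^ n
        ≤ max C 0 * (H : ℝ) ^ k * (1 + Real.log H) ^ m * (1 + Real.log β) ^ n := by gcongr
      _ ≤ max C 0 * (2 ^ k * β ^ ((k : ℝ) * θ)) * ((2 + θ) ^ m * (1 + Real.log β) ^ m) * (1 + Real.log β) ^ n := by gcongr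
      _ = max C 0 * 2 ^ k * (2 + θ) ^ m * (1 + Real.log β) ^ (m + n) * β ^ ((k : ℝ) * θ) := by ring
  specialize hβ₀ β hβ
  rw [div_le_iff₀ (Real.rpow_pos_of_pos hβ0 _)] at hβ₀
  rw [div_le_iff₀ hγ0, hsplit]
  calc C * (H : ℝ) ^ k * (1 + Real.log H) ^ m * (1 + Real.log β) ^ n
      ≤ max C 0 * 2 ^ k * (2 + θ) ^ m * (1 + Real.log β) ^ (m + n) * β ^ ((k : ℝ) * θ) := key
    _ ≤ ε * β ^ (γ - (k : ℝ) * θ) * β ^ ((k : ℝ) * θ) := mul_le_mul_of_nonneg_right hβ₀ (Real.rpow_nonneg hβ0.le _)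
    _ = ε * (β ^ ((k : ℝ) * θ) * β ^ (γ - (k : ℝ) * θ)) := by ring

/-! ## Exponentially small errors -/

/-- **Exponential errors**: `c, γ > 0` ⇒ `C·H^k·β^a·exp(−c·β^γ) ≤ ε` for `β ≥ β₀`, uniformly in `1 ≤ H ≤ β^θ + 1`. -/
theorem exists_forall_natPow_exp_le {θ γ c ε : ℝ} (hθ : 0 ≤ θ) (hγ : 0 < γ) (hc : 0 < c) (hε : 0 < ε) (C a : ℝ) (k : ℕ) :
    ∃ β₀ : ℝ, 1 ≤ β₀ ∧ ∀ β : ℝ, β₀ ≤ β → ∀ H : ℕ, 1 ≤ H → (H : ℝ) ≤ β ^ θ + 1 →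
      C * (H : ℝ) ^ k * β ^ a * Real.exp (-(c * β ^ γ)) ≤ ε := by
  -- `N` with `N γ ≥ kθ + |a| + 1`
  obtain ⟨N, hN⟩ : ∃ N : ℕ, ((k : ℝ) * θ + |a| + 1) / γ ≤ N := exists_nat_ge _
  have hNγ : (k : ℝ) * θ + |a| + 1 ≤ (N : ℝ) * γ := by rwa [div_le_iff₀ hγ] at hN
  set C'' : ℝ := max C 0 * 2 ^ k * ((N.factorial : ℝ) / c ^ N) with hC''
  have hC''0 : 0 ≤ C'' := by positivity
  obtain ⟨β₀, hβ₀1, hβ₀⟩ := exists_forall_log_pow_div_rpow_le one_pos hε C'' 0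
  refine ⟨β₀, hβ₀1, fun β hβ H hH1 hH => ?_⟩
  have hβ1 : 1 ≤ β := hβ₀1.trans hβ
  have hβ0 : 0 < β := by linarith
  specialize hβ₀ β hβ
  rw [pow_zero, mul_one, Real.rpow_one] at hβ₀
  have hC : C ≤ max C 0 := le_max_left _ _
  have hHk := natCast_pow_le hβ1 hθ hH k
  have hx : 0 < c * β ^ γ := mul_pos hc (Real.rpow_pos_of_pos hβ0 γ)
  -- `exp(−x) ≤ N!/x^N` for `x > 0` (✓`Real.pow_div_factorial_le_exp`; the tree's `Iwaniec1980b.exp_neg_le_factorial_div_pow`, inlined)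
  have hfac : Real.exp (-(c * β ^ γ)) ≤ (N.factorial : ℝ) / (c * β ^ γ) ^ N := by
    have h := Real.pow_div_factorial_le_exp (c * β ^ γ) hx.le N
    have hN : (0 : ℝ) < N.factorial := by exact_mod_cast Nat.factorial_pos N
    rw [div_le_iff₀ hN] at h
    rw [Real.exp_neg, inv_eq_one_div, div_le_div_iff₀ (Real.exp_pos _) (pow_pos hx N)]
    linarith
  have hexp : Real.exp (-(c * β ^ γ)) ≤ (N.factorial : ℝ) / c ^ N * β ^ (-((N : ℝ) * γ)) := by
    refine hfac.trans (le_of_eq ?_)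
    rw [mul_pow, ← Real.rpow_natCast (β ^ γ) N, ← Real.rpow_mul hβ0.le, Real.rpow_neg hβ0.le, mul_comm γ]
    field_simp
  have hE0 : 0 ≤ Real.exp (-(c * β ^ γ)) := (Real.exp_pos _).le
  -- the monomial `β^{kθ} β^a β^{−Nγ} ≤ β^{−1}`
  have hmono : β ^ ((k : ℝ) * θ) * β ^ a * β ^ (-((N : ℝ) * γ)) ≤ β ^ (-(1 : ℝ)) := by
    rw [← Real.rpow_add hβ0, ← Real.rpow_add hβ0]
    exact Real.rpow_le_rpow_of_exponent_le hβ1 (by linarith [le_abs_self a])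
  have hβinv : β ^ (-(1 : ℝ)) = 1 / β := by rw [Real.rpow_neg hβ0.le, Real.rpow_one, inv_eq_one_div]
  calc C * (H : ℝ) ^ k * β ^ a * Real.exp (-(c * β ^ γ))
      ≤ max C 0 * (H : ℝ) ^ k * β ^ a * Real.exp (-(c * β ^ γ)) := by
        have : 0 ≤ (H : ℝ) ^ k * β ^ a * Real.exp (-(c * β ^ γ)) := by positivity
        nlinarith
    _ ≤ max C 0 * (2 ^ k * β ^ ((k : ℝ) * θ)) * β ^ a * ((N.factorial : ℝ) / c ^ N * β ^ (-((N : ℝ) * γ))) := by gcongr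
    _ = C'' * (β ^ ((k : ℝ) * θ) * β ^ a * β ^ (-((N : ℝ) * γ))) := by rw [hC'']; ring
    _ ≤ C'' * β ^ (-(1 : ℝ)) := mul_le_mul_of_nonneg_left hmono hC''0
    _ = C'' / β := by rw [hβinv]; ring
    _ ≤ ε := hβ₀

/-- **Step C errors**: `γ₁, γ₁′ < γ₂`, `c > 0` ⇒ `C·H^k·β^a·exp(A·β^{γ₁} + A′·β^{γ₁′}·(1+log β)^m − c·β^{γ₂}) ≤ ε` for `β ≥ β₀`. -/
theorem exists_forall_natPow_exp_sub_le {θ γ₁ γ₁' γ₂ c ε : ℝ} (hθ : 0 ≤ θ) (hγ₂ : 0 < γ₂) (h1 : γ₁ < γ₂) (h1' : γ₁' < γ₂)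
    (hc : 0 < c) (hε : 0 < ε) (C a A A' : ℝ) (k m : ℕ) :
    ∃ β₀ : ℝ, 1 ≤ β₀ ∧ ∀ β : ℝ, β₀ ≤ β → ∀ H : ℕ, 1 ≤ H → (H : ℝ) ≤ β ^ θ + 1 →
      C * (H : ℝ) ^ k * β ^ a * Real.exp (A * β ^ γ₁ + A' * β ^ γ₁' * (1 + Real.log β) ^ m - c * β ^ γ₂) ≤ ε := by
  obtain ⟨β₁, hβ₁1, hβ₁⟩ := exists_forall_log_pow_div_rpow_le (sub_pos.2 h1) (by positivity : (0 : ℝ) < c / 4) (max A 0) 0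
  obtain ⟨β₂, -, hβ₂⟩ := exists_forall_log_pow_div_rpow_le (sub_pos.2 h1') (by positivity : (0 : ℝ) < c / 4) (max A' 0) m
  obtain ⟨β₃, -, hβ₃⟩ := exists_forall_natPow_exp_le hθ hγ₂ (by positivity : (0 : ℝ) < c / 2) hε (max C 0) a k
  refine ⟨max β₁ (max β₂ β₃), le_max_of_le_left hβ₁1, fun β hβ H hH1 hH => ?_⟩
  have hb1 : β₁ ≤ β := (le_max_left _ _).trans hβ
  have hb2 : β₂ ≤ β := ((le_max_left _ _).trans (le_max_right _ _)).trans hβ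
  have hb3 : β₃ ≤ β := ((le_max_right _ _).trans (le_max_right _ _)).trans hβ
  have hβ1 : 1 ≤ β := hβ₁1.trans hb1
  have hβ0 : 0 < β := by linarith
  -- the exponent is `≤ −(c/2) β^{γ₂}`
  have hpos2 : 0 < β ^ γ₂ := Real.rpow_pos_of_pos hβ0 _
  have e1 : A * β ^ γ₁ ≤ c / 4 * β ^ γ₂ := by
    have h := hβ₁ β hb1
    rw [pow_zero, mul_one, div_le_iff₀ (Real.rpow_pos_of_pos hβ0 _)] at h
    have hsplit : β ^ γ₂ = β ^ γ₁ * β ^ (γ₂ - γ₁) := by rw [← Real.rpow_add hβ0]; ring_nf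
    rw [hsplit]
    calc A * β ^ γ₁ ≤ max A 0 * β ^ γ₁ := mul_le_mul_of_nonneg_right (le_max_left _ _) (Real.rpow_nonneg hβ0.le _)
      _ ≤ c / 4 * β ^ (γ₂ - γ₁) * β ^ γ₁ := mul_le_mul_of_nonneg_right h (Real.rpow_nonneg hβ0.le _)
      _ = c / 4 * (β ^ γ₁ * β ^ (γ₂ - γ₁)) := by ring
  have e2 : A' * β ^ γ₁' * (1 + Real.log β) ^ m ≤ c / 4 * β ^ γ₂ := by
    have h := hβ₂ β hb2
    rw [div_le_iff₀ (Real.rpow_pos_of_pos hβ0 _)] at h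
    have hsplit : β ^ γ₂ = β ^ γ₁' * β ^ (γ₂ - γ₁') := by rw [← Real.rpow_add hβ0]; ring_nf
    rw [hsplit]
    have hL : 0 ≤ (1 + Real.log β) ^ m := pow_nonneg (one_add_log_nonneg hβ1) m
    calc A' * β ^ γ₁' * (1 + Real.log β) ^ m ≤ max A' 0 * β ^ γ₁' * (1 + Real.log β) ^ m := by
          gcongr; exact le_max_left _ _
      _ = max A' 0 * (1 + Real.log β) ^ m * β ^ γ₁' := by ring
      _ ≤ c / 4 * β ^ (γ₂ - γ₁') * β ^ γ₁' := mul_le_mul_of_nonneg_right h (Real.rpow_nonneg hβ0.le _)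
      _ = c / 4 * (β ^ γ₁' * β ^ (γ₂ - γ₁')) := by ring
  have hexp : Real.exp (A * β ^ γ₁ + A' * β ^ γ₁' * (1 + Real.log β) ^ m - c * β ^ γ₂) ≤ Real.exp (-(c / 2 * β ^ γ₂)) :=
    Real.exp_le_exp.2 (by linarith)
  have h3 := hβ₃ β hb3 H hH1 hH
  calc C * (H : ℝ) ^ k * β ^ a * Real.exp (A * β ^ γ₁ + A' * β ^ γ₁' * (1 + Real.log β) ^ m - c * β ^ γ₂)
      ≤ max C 0 * (H : ℝ) ^ k * β ^ a * Real.exp (A * β ^ γ₁ + A' * β ^ γ₁' * (1 + Real.log β) ^ m - c * β ^ γ₂) := by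
        have : 0 ≤ (H : ℝ) ^ k * β ^ a * Real.exp (A * β ^ γ₁ + A' * β ^ γ₁' * (1 + Real.log β) ^ m - c * β ^ γ₂) := by
          positivity
        nlinarith [le_max_left C 0]
    _ ≤ max C 0 * (H : ℝ) ^ k * β ^ a * Real.exp (-(c / 2 * β ^ γ₂)) := by gcongr
    _ ≤ ε := h3

/-! ## The six errors of ASSEMBLY-S5 §6 at the exponents of §1/§7 -/

/-- Conjunction of two «for `β ≥ β₀`, for all admissible `H`» statements. -/
theorem exists_forall_and {P Q : ℝ → ℕ → Prop}
    (hP : ∃ β₀ : ℝ, 1 ≤ β₀ ∧ ∀ β : ℝ, β₀ ≤ β → ∀ H : ℕ, P β H) (hQ : ∃ β₀ : ℝ, 1 ≤ β₀ ∧ ∀ β : ℝ, β₀ ≤ β → ∀ H : ℕ, Q β H) :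
    ∃ β₀ : ℝ, 1 ≤ β₀ ∧ ∀ β : ℝ, β₀ ≤ β → ∀ H : ℕ, P β H ∧ Q β H := by
  obtain ⟨b₁, hb₁, h₁⟩ := hP
  obtain ⟨b₂, -, h₂⟩ := hQ
  exact ⟨max b₁ b₂, le_max_of_le_left hb₁, fun β hβ H => ⟨h₁ β ((le_max_left _ _).trans hβ) H, h₂ β ((le_max_right _ _).trans hβ) H⟩⟩

/-- **`errorBudget_six`** — ASSEMBLY-S5 §6 (e1)–(e6) as nine monomial largeness conditions: for `0 < θ`, `12θ < 1`, `θ/2 < κ₃ < (1/2 − 4θ)/3`,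
`κ₃ < ε₁ < 1/2 − 6θ + 2κ₃`, `c > 0` and any `C`, `m`, there is `β₀ ≥ 1` past which, for every `H` with `β^θ ≤ H ≤ β^θ + 1`:
(e1) `C H⁸β² e^{−cH⁴} ≤ 1/32`, `C H¹²β² e^{−cβ^{2ε₁}} ≤ 1/32`; (e2) `C H¹²β² exp(Cβ^θ + Cβ^{6θ+ε₁−1/2}(1+log β)^m − cβ^{2κ₃}) ≤ 1/32`;
(e3)/(e6) `C H¹⁰β² e^{−(c/2)β^{2κ₃}} ≤ 1/32`, `C H⁸/β ≤ 1/32`; (e4) `C H¹⁰(1+log H)^m β^{−1+2κ₃} ≤ 1/32`, `C H¹²(1+log H)^m/β ≤ 1/32`,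
`C H¹⁴(1+log H)^m β^{−3/2+3κ₃} ≤ 1/32`; (e5) `C H¹²(1+log H)^m/β · (1 + H⁴β^{−1+4κ₃}) ≤ 1/32`. -/
theorem errorBudget_six {θ κ₃ ε₁ c : ℝ} (hθ : 0 < θ) (h12 : 12 * θ < 1) (hκl : θ / 2 < κ₃) (hκu : κ₃ < (1 / 2 - 4 * θ) / 3)
    (hε₁l : κ₃ < ε₁) (hε₁u : ε₁ < 1 / 2 - 6 * θ + 2 * κ₃) (hc : 0 < c) (C : ℝ) (m : ℕ) :
    ∃ β₀ : ℝ, 1 ≤ β₀ ∧ ∀ β : ℝ, β₀ ≤ β → ∀ H : ℕ, 1 ≤ H → β ^ θ ≤ (H : ℝ) → (H : ℝ) ≤ β ^ θ + 1 →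
      (C * (H : ℝ) ^ 8 * β ^ 2 * Real.exp (-(c * (H : ℝ) ^ 4)) ≤ 1 / 32 ∧
        C * (H : ℝ) ^ 12 * β ^ 2 * Real.exp (-(c * β ^ (2 * ε₁))) ≤ 1 / 32) ∧
      C * (H : ℝ) ^ 12 * β ^ 2 * Real.exp (C * β ^ θ + C * β ^ (6 * θ + ε₁ - 1 / 2) * (1 + Real.log β) ^ m - c * β ^ (2 * κ₃)) ≤ 1 / 32 ∧
      (C * (H : ℝ) ^ 10 * β ^ 2 * Real.exp (-(c / 2 * β ^ (2 * κ₃))) ≤ 1 / 32 ∧ C * (H : ℝ) ^ 8 / β ≤ 1 / 32) ∧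
      (C * (H : ℝ) ^ 10 * (1 + Real.log H) ^ m * β ^ (-1 + 2 * κ₃) ≤ 1 / 32 ∧
        C * (H : ℝ) ^ 12 * (1 + Real.log H) ^ m / β ≤ 1 / 32 ∧
        C * (H : ℝ) ^ 14 * (1 + Real.log H) ^ m * β ^ (-3 / 2 + 3 * κ₃) ≤ 1 / 32) ∧
      C * (H : ℝ) ^ 12 * (1 + Real.log H) ^ m / β * (1 + (H : ℝ) ^ 4 * β ^ (-1 + 4 * κ₃)) ≤ 1 / 32 := by
  have hθ0 : 0 ≤ θ := hθ.le
  have h32 : (0 : ℝ) < 1 / 32 := by norm_num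
  have h64 : (0 : ℝ) < 1 / 64 := by norm_num
  -- the nine thresholds
  obtain ⟨b₁, hb₁1, hb₁⟩ := exists_forall_natPow_exp_le hθ0 (by positivity : 0 < 4 * θ) hc h32 (max C 0) 2 8
  obtain ⟨b₂, hb₂1, hb₂⟩ := exists_forall_natPow_exp_le hθ0 (by linarith : 0 < 2 * ε₁) hc h32 C 2 12
  obtain ⟨b₃, hb₃1, hb₃⟩ := exists_forall_natPow_exp_sub_le hθ0 (by linarith : 0 < 2 * κ₃) (by linarith : θ < 2 * κ₃)
    (by linarith : 6 * θ + ε₁ - 1 / 2 < 2 * κ₃) hc h32 C 2 C C 12 m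
  obtain ⟨b₄, hb₄1, hb₄⟩ := exists_forall_natPow_exp_le hθ0 (by linarith : 0 < 2 * κ₃) (by positivity : 0 < c / 2) h32 C 2 10
  obtain ⟨b₅, hb₅1, hb₅⟩ := exists_forall_natPow_log_le (k := 8) (γ := 1) hθ0 (by push_cast; linarith) h32 C 0 0
  obtain ⟨b₆, hb₆1, hb₆⟩ := exists_forall_natPow_log_le (k := 10) (γ := 1 - 2 * κ₃) hθ0 (by push_cast; linarith) h32 C m 0
  obtain ⟨b₇, hb₇1, hb₇⟩ := exists_forall_natPow_log_le (k := 12) (γ := 1) hθ0 (by push_cast; linarith) h32 C m 0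
  obtain ⟨b₈, hb₈1, hb₈⟩ := exists_forall_natPow_log_le (k := 14) (γ := 3 / 2 - 3 * κ₃) hθ0 (by push_cast; linarith) h32 C m 0
  obtain ⟨b₉, hb₉1, hb₉⟩ := exists_forall_natPow_log_le (k := 12) (γ := 1) hθ0 (by push_cast; linarith) h64 C m 0
  obtain ⟨b₀, hb₀1, hb₀⟩ := exists_forall_natPow_log_le (k := 16) (γ := 2 - 4 * κ₃) hθ0 (by push_cast; linarith) h64 C m 0
  refine ⟨max (max (max b₁ b₂) (max b₃ b₄)) (max (max b₅ b₆) (max (max b₇ b₈) (max b₉ b₀))), le_max_of_le_left (le_max_of_le_left (le_max_of_le_left hb₁1)),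
    fun β hβ H hH1 hHl hHu => ?_⟩
  simp only [max_le_iff] at hβ
  obtain ⟨⟨⟨hβ1, hβ2⟩, hβ3, hβ4⟩, ⟨hβ5, hβ6⟩, ⟨hβ7, hβ8⟩, hβ9, hβ0⟩ := hβ
  have hb1 : 1 ≤ β := hb₁1.trans hβ1
  have hb0 : 0 < β := by linarith
  have hrpow2 : β ^ (2 : ℝ) = β ^ 2 := Real.rpow_two β
  have hH0 : 0 ≤ (H : ℝ) := Nat.cast_nonneg H
  have hL0 : 0 ≤ (1 + Real.log (H : ℝ)) ^ m := pow_nonneg (one_add_log_nonneg (by exact_mod_cast hH1)) m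
  refine ⟨⟨?_, ?_⟩, ?_, ⟨?_, ?_⟩, ⟨?_, ?_, ?_⟩, ?_⟩
  · -- (e1a): `exp(−cH⁴) ≤ exp(−cβ^{4θ})` since `β^θ ≤ H`
    have h4 : β ^ (4 * θ) ≤ (H : ℝ) ^ 4 := by
      rw [mul_comm, Real.rpow_mul hb0.le, show ((4 : ℝ)) = ((4 : ℕ) : ℝ) by norm_num, Real.rpow_natCast]
      exact pow_le_pow_left₀ (Real.rpow_nonneg hb0.le θ) hHl 4
    have hexp : Real.exp (-(c * (H : ℝ) ^ 4)) ≤ Real.exp (-(c * β ^ (4 * θ))) :=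
      Real.exp_le_exp.2 (by nlinarith)
    have h := hb₁ β hβ1 H hH1 hHu
    rw [hrpow2] at h
    calc C * (H : ℝ) ^ 8 * β ^ 2 * Real.exp (-(c * (H : ℝ) ^ 4))
        ≤ max C 0 * (H : ℝ) ^ 8 * β ^ 2 * Real.exp (-(c * (H : ℝ) ^ 4)) := by
          have : 0 ≤ (H : ℝ) ^ 8 * β ^ 2 * Real.exp (-(c * (H : ℝ) ^ 4)) := by positivity
          nlinarith [le_max_left C 0]
      _ ≤ max C 0 * (H : ℝ) ^ 8 * β ^ 2 * Real.exp (-(c * β ^ (4 * θ))) := by gcongr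
      _ ≤ 1 / 32 := h
  · have h := hb₂ β hβ2 H hH1 hHu
    rwa [hrpow2] at h
  · have h := hb₃ β hβ3 H hH1 hHu
    rwa [hrpow2] at h
  · have h := hb₄ β hβ4 H hH1 hHu
    rwa [hrpow2] at h
  · have h := hb₅ β hβ5 H hH1 hHu
    simpa only [pow_zero, mul_one, Real.rpow_one] using h
  · have h := hb₆ β hβ6 H hH1 hHu
    rw [pow_zero, mul_one] at h
    have e : β ^ (-1 + 2 * κ₃) = 1 / β ^ (1 - 2 * κ₃) := by
      rw [show -1 + 2 * κ₃ = -(1 - 2 * κ₃) by ring, Real.rpow_neg hb0.le, inv_eq_one_div]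
    rw [e, mul_one_div]
    exact h
  · have h := hb₇ β hβ7 H hH1 hHu
    simpa only [pow_zero, mul_one, Real.rpow_one] using h
  · have h := hb₈ β hβ8 H hH1 hHu
    rw [pow_zero, mul_one] at h
    have e : β ^ (-3 / 2 + 3 * κ₃) = 1 / β ^ (3 / 2 - 3 * κ₃) := by
      rw [show -3 / 2 + 3 * κ₃ = -(3 / 2 - 3 * κ₃) by ring, Real.rpow_neg hb0.le, inv_eq_one_div]
    rw [e, mul_one_div]
    exact h
  · -- (e5): split `1 + H⁴β^{−1+4κ₃}`
    have h9 := hb₉ β hβ9 H hH1 hHu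
    have h0 := hb₀ β hβ0 H hH1 hHu
    rw [pow_zero, mul_one, Real.rpow_one] at h9
    rw [pow_zero, mul_one] at h0
    have e : C * (H : ℝ) ^ 12 * (1 + Real.log H) ^ m / β * (1 + (H : ℝ) ^ 4 * β ^ (-1 + 4 * κ₃)) =
        C * (H : ℝ) ^ 12 * (1 + Real.log H) ^ m / β + C * (H : ℝ) ^ 16 * (1 + Real.log H) ^ m / β ^ (2 - 4 * κ₃) := by
      have e1 : β ^ (2 - 4 * κ₃) = β * β ^ (1 - 4 * κ₃) := by
        rw [show (2 : ℝ) - 4 * κ₃ = 1 + (1 - 4 * κ₃) by ring, Real.rpow_add hb0, Real.rpow_one]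
      have e2 : β ^ (-1 + 4 * κ₃) = (β ^ (1 - 4 * κ₃))⁻¹ := by
        rw [show -1 + 4 * κ₃ = -(1 - 4 * κ₃) by ring, Real.rpow_neg hb0.le]
      rw [e1, e2]
      have hne : β ^ (1 - 4 * κ₃) ≠ 0 := (Real.rpow_pos_of_pos hb0 _).ne'
      field_simp
    rw [e]
    linarith

end ErrorBudget

end Summit.QuantumFields.YangMills.Theorems.AllWindowsColdBoxBoxHighLine

end
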